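import Mathlib

/-!
# EriceRemainderEnclosureHistoryAutonomyComparisonAgeCompositionStaticChainWindowMass — (E74a) THE WINDOW-MASS CHAIN: the denominator of the static-chain step
# is `1 − Ω` with `Ω ≤ Ω^u := Σ_{k older} x_k·(y∕k)` (undamped old kernel mass inside the young window), NOT `1 − √2·W`; the normal form becomes
# `ρ ≤ (lone cap of the young age) + x·V`, the closure threshold on «young load × chain load» rises from `1 − √2∕2 = 0.2929` to `1 − y∕(2S_{y,y})`
# (`→ 0.3964`), and the pure spike is alive for EVERY defect

Cell `pub-balaban`, β-function sub-cell, BINDER row D4 «RemainderConst leaves for Bałaban's split» (`HOME/BINDER-OWNERS.md`; owner lineage `b2b-balaban-beta-an4`;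
this file by co-owner #2 lineage `b2b-balaban-beta-d4-p2`, generation 65), β-FLOW TEAM duty (1), FREEZE (0) honoured (def-free, Mathlib only; (E65a), (E71c)–(E71d),
(E72a)–(E72e), (E73a)–(E73d) are referred to BY NAME, nothing restated).

HONEST FRAMING (page 1, verbatim and binding).  *"Discharging BetaPertH makes Bałaban's UV stability UNCONDITIONAL — a real constructive-QFT result; it is
NOT the continuum limit and NOT the Clay problem."*  THIS FILE DISCHARGES NOTHING OF THE KIND.  Elementary algebra of finite sums of real numbers and three
certified decimal inequalities — hypotheses of a census, not facts; the form, signs, ages and moments of Bałaban's (1.22) limit functional are NOT PRINTED ([I] p. 298;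
GAPS G-t4-U2-1∕-2) and NOT asserted.  Row D4 class UNCHANGED (critical-path width 0; instance 0∕1; D4 DISCHARGE NO DATE).  HONEST DEPENDENCY: continuum YM on T⁴ ⇐
BetaPertH ∧ nine spine estimates (0/9 proved); BetaPertH ⇐ (D1) ∧ (D4) ∧ CAP+tail; G-an2-4 gates asym, D1 and NE2/3/4.

THE POINT (census sense (α); route (N), READMEs `g62/e71` §PS, `g63/e72`, `g64/e73`, `g65/e74`).  In (E71c) `key_of_harnack_load` the KEY inequality at a pin is
`x̃·(v + S) ≤ (1 − Ω)·v` with `Ω = Σ_k Σ_{i<y} E k m i` the OLD KERNEL MASS INSIDE THE YOUNG WINDOW; undamped (`g ≤ 1`), an older age `k > y` with budget load `x_k`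
(row mass `k·c_{m,k}`) contributes at most `c_{m,k}·y = x_k·(y∕k)`.  Route (N) (g62 §PS2 (i)) continued with `x_k·y∕k ≤ √2·x_k·S_{k,y}∕k` (`S_{k,y} ≥ y∕√2`) and
ran the crude chain with the denominator `1 − √2·W`, `W = Σ_k x_k S_{k,y}∕k` the older usage of (E65a)'s budget at the young scale.  THIS FILE KEEPS
`Ω^u := Σ_{k older} x_k·(y∕k)` ITSELF — an equally admissible datum of the static chain ((E72a) `chain_le_of_data_le`: the chain is monotone in `Ω`), termwise
`≤ c_Ω·W` with **`c_Ω = y∕S_{y+1,y}`** (`S_{k,y}` is non-decreasing in `k`, §2 `readWindow_mono_left`): `c_Ω = 1.2247 (y = 1), 1.219 (y = 2), → 1∕(2(√2−1)) =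
1.2071`, against `√2 = 1.4142`; `c_Ω ≤ √2` always (`cOmega_le_sqrt_two`), so the window-mass chain is NEVER worse than route (N)'s.
§1 **THE WINDOW-MASS NORMAL FORM** (`key_ratio_le_window_mass_form`, **`key_ratio_le_cap_add_product`**, `key_ratio_lt_one_of_product_lt_crit`, `crit_mono`):
with `Ω ≤ cW`, `s·x + W ≤ ½`, `c·s ≤ 1` (here `c_Ω·s_y = S_{y,y}∕S_{y+1,y} ≤ 1`, `cOmega_mul_s_le_one` — route (N)'s lemma needed `c·s ≥ 1`), `c < 2` and
`x·V ≤ T ≤ 1 − 1∕(2s)`: **`ρ = x(1+V)∕(1−Ω) ≤ 1∕(2s) + T`** — THE LONE CAP OF THE YOUNG AGE PLUS «YOUNG LOAD × CHAIN LOAD» (equality at the lone saturated age).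
Hence CLOSURE AT A STEP WITH YOUNG AGE `y` ⟸ **`x·V < 1 − y∕(2S_{y,y})`** = `0.2929 (y=1), 0.344 (2), 0.361 (3), 0.370 (4), 0.386 (10), ≥ 0.3911 (y ≥ 40,
§3 `telescope_ge_forty` + (E72d) `le_readWindow_ratio`), → 1 − (√2+1)∕4 = 0.3964` — route (N) needed `x·V < 0.2929` AT EVERY `y`, and its binding regime
(dense block just above a LARGE young age, README g64/e73 §5: continuum `sup x·V ≈ 0.265`, margin 9–10 %) is exactly where the new threshold is `0.396`.
§2 the constants (`window_mass_weight_le`, **`window_mass_le_mul_usage`**, `cOmega_mul_s_le_one`, `readWindow_succ_ge`, `cOmega_le_sqrt_two`).  §4 **THE PURE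
SPIKE IS ALIVE FOR EVERY DEFECT** (`pure_spike_alive_all_defects`, `pure_spike_closed_form_alive`, `pure_spike_denominator_pos`): with the window-mass constants
(`κ = 1` since `y∕k ≤ 1`, `D₀ = 1`, `a = 1 − θ`) the closed-form exponent of (E72e)∕(E73a) is `q(X) = (1−X)^{−(1−θ)}` and **`θ·q(X) < 1` for every `0 < θ < 1`
and every `X ≤ 5∕8`** (`⊇ [0, (√2+1)∕4]`, the single-scale cap): `log θ < θ − 1` and `3∕8 > e⁻¹`; blow-up load `X⋆(θ) = 1 − θ^{1∕(1−θ)} > 1 − e⁻¹ = 0.632 >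
0.6036` — for route (N)'s `κ = 4 − 2√2` it was alive only because `θ̄(1) = 0.7856 < 0.7987` ((E73d), margin 0.021 in load; here 0.072 at `θ̄(1)` and positive
for all `θ`).  §5 **`window_mass_step_closes`**: the packaged step criterion (budget at the young scale + `x₀·V ≤ T < 1 − y∕(2S_{y,y})` ⟹ `ρ < 1` with the
denominator `1 − Σ_i x_i·y∕k_i`), ready for the identification file.

NUMERICS OF RECORD (`HOME/b2b-balaban-beta-d4-p2/g65/numerics/`, TRUE chains with exact charges, both denominators side by side; README `g65/e74/README.md`):
README g64 §5's continuum maximisers re-read with the window-mass denominator at `z = 512`: `ρ_z 0.831 → 0.524`, `0.814 → 0.515`, `x·V 0.2506 → 0.177`,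
`0.2519 → 0.178` (`Ω^u = 0.50` vs `√2W = 0.60`; member ratios smaller, compounding `E 6.7 → 5.1`); small young ages (adversarial over (E65a)'s polytope, all
scales): `sup ρ = 0.731 {1,2}, 0.742 {1..8}, 0.752 {1..16} ∕ 2^{0..6}, 0.686 {2..8}, 0.669 {3..12}` (route (N): 0.738, 0.755, 0.763 ∕ 0.765, 0.697, 0.684) —
the global supremum of the window-mass chain is the PERTURBATIVE `y = 1` regime (lone cap 0.707 + far dust), where `x·V ≤ 0.08`; pure adjacent spike
(worst-constant fluid, closed form): `sup ρ = 0.615` at `X = 0.22`, `sup x·V = 0.154`, value at the cap `E = 6.2` (route (N): 0.704, 0.185, 16.3); THE BIN-CHAIN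
MAJORANT OF README g64 §4 WITH OUTER (min-charge, rigorous-direction) BUDGETS, which EXPLODED for route (N) (10²–10³ at every `N ≤ 80`), is FINITE AND CLOSING
for the window-mass chain from `N = 20` ratio bins per 5 octaves on: dead-fluid-aware ascent `sup Φ_T = 0.255 (N=20), 0.225 (40), 0.204 (80)`, `sup Φ_ρ = 0.77
(20), 0.71 (40), 0.70 (80)` at `z = 48` (far teeth included: 0.220∕0.711 at N = 40; `z = 96`: 0.214∕0.709), no outer-feasible dead fluid found — a certification
path (README §6) is open.  §6 (appended): `pure_spike_hqM` — §4 in the exp∕log letters of (E73a) `spike_le_closed_form` (its hypothesis `hqM` on the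
whole budget, for every defect).  NOT CLAIMED: the static closure; a certified bound of any supremum; the identification `Ω_m ≤ Ω^u` as a Lean statement about (E71c)'s
kernels (identification file); MONO; (E58′); anything nonlinear; anything printed.
-/
noncomputable section
open Finset

namespace Summit.QuantumFields.BalabanUV.Beta.EriceRemainderEnclosureHistoryAutonomyComparisonAgeCompositionStaticChainWindowMass

/-! ## §1 The window-mass normal form: `ρ ≤ (lone cap) + x·V` -/

/-- `(x + T)∕(d + e·x)` is non-decreasing in `x ≥ 0` when `e·T ≤ d`, `d > 0`, `e ≥ 0`. [folklore] -/
theorem add_div_affine_mono {x X T d e : ℝ} (hx : 0 ≤ x) (hxX : x ≤ X) (he : 0 ≤ e) (heT : e * T ≤ d) (hd : 0 < d) :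
    (x + T) / (d + e * x) ≤ (X + T) / (d + e * X) := by
  have h1 : 0 < d + e * x := by positivity
  have h2 : 0 < d + e * X := by have : 0 ≤ e * X := mul_nonneg he (hx.trans hxX); linarith
  rw [div_le_div_iff₀ h1 h2]
  nlinarith [mul_nonneg (sub_nonneg.mpr hxX) (sub_nonneg.mpr heT)]

/-- **THE WINDOW-MASS FORM OF A STATIC-CHAIN STEP.**  Young load `x ≥ 0`, chain load `V ≥ 0`, older usage `W ≥ 0` of the young scale's budget with
`s·x + W ≤ ½` (`s > 0`), older window mass `Ω ≤ c·W` with `0 ≤ c < 2`.  Then the denominator is positive, `1 − Ω ≥ (1 − c∕2) + c·s·x`, and for any `T ≥ x·V`: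
**`ρ = x(1+V)∕(1−Ω) ≤ (x + T)∕((1 − c∕2) + c·s·x)`**.  (No hypothesis `c·s ≥ 1`: this is the form the WINDOW-MASS chain uses, `c = y∕S_{y+1,y}`, `s = S_{y,y}∕y`,
`c·s = S_{y,y}∕S_{y+1,y} ≤ 1`.) [folklore] -/
theorem key_ratio_le_window_mass_form {x V Ω W s c T : ℝ} (hx : 0 ≤ x) (hV : 0 ≤ V) (hΩ : Ω ≤ c * W) (hc : 0 ≤ c)
    (hbudget : s * x + W ≤ 1 / 2) (hs : 0 < s) (hc2 : c < 2) (hT : x * V ≤ T) :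
    0 < 1 - Ω ∧ (1 - c / 2) + c * s * x ≤ 1 - Ω ∧ x * (1 + V) / (1 - Ω) ≤ (x + T) / ((1 - c / 2) + c * s * x) := by
  have hden : (1 - c / 2) + c * s * x ≤ 1 - Ω := by nlinarith [mul_le_mul_of_nonneg_left hbudget hc]
  have hpos : 0 < (1 - c / 2) + c * s * x := by
    have : 0 ≤ c * s * x := by positivity
    linarith
  refine ⟨lt_of_lt_of_le hpos hden, hden, ?_⟩
  exact div_le_div₀ (by nlinarith) (by nlinarith) hpos hden

/-- **THE WINDOW-MASS NORMAL FORM: `ρ ≤ 1∕(2s) + T` — THE LONE CAP PLUS «YOUNG LOAD × CHAIN LOAD».**  In the setting of `key_ratio_le_window_mass_form` with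
`c·s ≤ 1` and `x·V ≤ T ≤ 1 − 1∕(2s)`: **`ρ ≤ 1∕(2s) + T`**, where `1∕(2s) = y∕(2S_{y,y})` is exactly the LONE-AGE CAP of the young age (`0.707, 0.656, 0.639,
0.630, …, → (√2+1)∕4 = 0.6036`).  Proof: `x ≤ 1∕(2s)` from the budget, and `(x+T)∕((1−c∕2)+csx)` is non-decreasing in `x` because `cs·T ≤ cs − c∕2 ≤ 1 − c∕2`;
at `x = 1∕(2s)` the bound reads `(1∕(2s) + T)∕(1 − c∕2 + c∕2)`.  Equality at the lone saturated age.  So, for the window-mass chain, CLOSURE AT A STEP WITH YOUNG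
AGE `y` ⟸ **`x·V < 1 − y∕(2S_{y,y})`** (`= 0.2929` at `y = 1`, `0.344` at `y = 2`, `0.370` at `y = 4`, `≥ 0.391` for `y ≥ 40`, `→ 1 − (√2+1)∕4 = 0.3964`),
against route (N)'s uniform `x·V < 1 − √2∕2 = 0.2929` for the `√2·W` chain. [folklore] -/
theorem key_ratio_le_cap_add_product {x V Ω W s c T : ℝ} (hx : 0 ≤ x) (hV : 0 ≤ V) (hW : 0 ≤ W) (hΩ : Ω ≤ c * W) (hc : 0 ≤ c)
    (hbudget : s * x + W ≤ 1 / 2) (hs : 0 < s) (hcs : c * s ≤ 1) (hc2 : c < 2) (hT : x * V ≤ T) (hTc : T ≤ 1 - 1 / (2 * s)) :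
    0 < 1 - Ω ∧ x * (1 + V) / (1 - Ω) ≤ 1 / (2 * s) + T := by
  obtain ⟨hpos, hden, hle⟩ := key_ratio_le_window_mass_form hx hV hΩ hc hbudget hs hc2 hT
  refine ⟨hpos, hle.trans ?_⟩
  have hxmax : x ≤ 1 / (2 * s) := by
    rw [le_div_iff₀ (by positivity)]; nlinarith
  have hd : 0 < 1 - c / 2 := by linarith
  have heT : c * s * T ≤ 1 - c / 2 := by
    have h1 : c * s * T ≤ c * s * (1 - 1 / (2 * s)) := mul_le_mul_of_nonneg_left hTc (by positivity)
    have h2 : c * s * (1 - 1 / (2 * s)) = c * s - c / 2 := by field_simp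
    nlinarith
  calc (x + T) / ((1 - c / 2) + c * s * x) ≤ (1 / (2 * s) + T) / ((1 - c / 2) + c * s * (1 / (2 * s))) :=
        add_div_affine_mono hx hxmax (by positivity) heT hd
    _ = 1 / (2 * s) + T := by
        have : (1 - c / 2) + c * s * (1 / (2 * s)) = 1 := by field_simp; ring
        rw [this, div_one]

/-- **CLOSURE CRITERION (window-mass chain).**  In the setting of `key_ratio_le_cap_add_product`: `x·V ≤ T < 1 − 1∕(2s)` gives `ρ < 1`. [folklore] -/
theorem key_ratio_lt_one_of_product_lt_crit {x V Ω W s c T : ℝ} (hx : 0 ≤ x) (hV : 0 ≤ V) (hW : 0 ≤ W) (hΩ : Ω ≤ c * W) (hc : 0 ≤ c)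
    (hbudget : s * x + W ≤ 1 / 2) (hs : 0 < s) (hcs : c * s ≤ 1) (hc2 : c < 2) (hT : x * V ≤ T) (hTc : T < 1 - 1 / (2 * s)) :
    x * (1 + V) / (1 - Ω) < 1 := by
  have h := key_ratio_le_cap_add_product hx hV hW hΩ hc hbudget hs hcs hc2 hT hTc.le
  linarith [h.2]

/-- The criterion as a uniform threshold: if the own-scale weight satisfies `S_{y,y} ≥ σ·y` (`σ > 0`), then `1 − 1∕(2s) ≥ 1 − 1∕(2σ)` for `s = S_{y,y}∕y`;
with `σ = 1∕√2` (every `y ≥ 1`, (E65a)) the threshold is `≥ 1 − √2∕2`, with `σ = 0.8211` (`y ≥ 40`, §3) it is `≥ 0.391`. [folklore] -/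
theorem crit_mono {s σ : ℝ} (hσ : 0 < σ) (hs : σ ≤ s) : 1 - 1 / (2 * σ) ≤ 1 - 1 / (2 * s) := by
  have : 1 / (2 * s) ≤ 1 / (2 * σ) := one_div_le_one_div_of_le (by positivity) (by linarith)
  linarith

/-! ## §2 The constants of the window-mass chain: `Ω^u ≤ c_Ω·W`, `c_Ω = y∕S_{y+1,y}`, `c_Ω·s_y ≤ 1`, `c_Ω ≤ √2 < 2` -/

/-- The window-read summand `√(k∕(k+l+1))` is non-decreasing in `k ≥ 0`. [folklore] -/
theorem sqrt_summand_mono {k k' : ℝ} (hk : 0 ≤ k) (hkk : k ≤ k') (l : ℕ) :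
    Real.sqrt (k / (k + l + 1)) ≤ Real.sqrt (k' / (k' + l + 1)) := by
  apply Real.sqrt_le_sqrt
  have hl : (0 : ℝ) ≤ l := Nat.cast_nonneg l
  rw [div_le_div_iff₀ (by positivity) (by linarith)]
  nlinarith

/-- **THE WINDOW READ IS NON-DECREASING IN THE AGE**: `S_{k,j} ≤ S_{k',j}` for `0 ≤ k ≤ k'`. [folklore] -/
theorem readWindow_mono_left {k k' : ℝ} (hk : 0 ≤ k) (hkk : k ≤ k') (j : ℕ) :
    ∑ l ∈ range j, Real.sqrt (k / (k + l + 1)) ≤ ∑ l ∈ range j, Real.sqrt (k' / (k' + l + 1)) :=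
  sum_le_sum fun l _ => sqrt_summand_mono hk hkk l

/-- Termwise domination of the WINDOW-MASS weight by the window-read weight: for an older age `k ≥ y + 1` of a young age `y`,
`y∕k ≤ (y∕S_{y+1,y})·(S_{k,y}∕k)` — because `S_{y+1,y} ≤ S_{k,y}`. [folklore] -/
theorem window_mass_weight_le {y k : ℝ} (hy : 0 < y) (hk : y + 1 ≤ k) (n : ℕ)
    (hS1 : 0 < ∑ l ∈ range n, Real.sqrt ((y + 1) / ((y + 1) + l + 1))) :
    y / k ≤ (y / ∑ l ∈ range n, Real.sqrt ((y + 1) / ((y + 1) + l + 1))) * ((∑ l ∈ range n, Real.sqrt (k / (k + l + 1))) / k) := by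
  have hk0 : 0 < k := by linarith
  have hmono := readWindow_mono_left (k := y + 1) (k' := k) (by linarith) hk n
  rw [div_mul_div_comm, div_le_div_iff₀ hk0 (mul_pos hS1 hk0)]
  calc y * ((∑ l ∈ range n, Real.sqrt ((y + 1) / ((y + 1) + l + 1))) * k)
      ≤ y * ((∑ l ∈ range n, Real.sqrt (k / (k + l + 1))) * k) := by
        apply mul_le_mul_of_nonneg_left _ hy.le
        exact mul_le_mul_of_nonneg_right hmono hk0.le
    _ = y * (∑ l ∈ range n, Real.sqrt (k / (k + l + 1))) * k := by ring

/-- **WINDOW MASS ≤ `c_Ω` × USAGE.**  For a young age `y > 0`, older ages `k_i ≥ y + 1` with loads `x_i ≥ 0`, and `c = y∕S_{y+1,y}` (window read with `n`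
summands, `n = y` in the chain): `Σ_i x_i·(y∕k_i) ≤ c · Σ_i x_i·(S_{k_i,y}∕k_i)` — the undamped window mass `Ω^u` is at most `c_Ω` times the older usage `W`
of the young scale's budget.  (`c_Ω = 1.2247` at `y = 1`, `1.219` at `y = 2`, `→ 1∕(2(√2−1)) = 1.2071`; route (N) used `√2 = 1.4142`.) [folklore] -/
theorem window_mass_le_mul_usage {ι : Type*} (I : Finset ι) {y : ℝ} (hy : 0 < y) (n : ℕ) (kk x : ι → ℝ)
    (hk : ∀ i ∈ I, y + 1 ≤ kk i) (hx : ∀ i ∈ I, 0 ≤ x i)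
    (hS1 : 0 < ∑ l ∈ range n, Real.sqrt ((y + 1) / ((y + 1) + l + 1))) :
    ∑ i ∈ I, x i * (y / kk i) ≤
      (y / ∑ l ∈ range n, Real.sqrt ((y + 1) / ((y + 1) + l + 1))) * ∑ i ∈ I, x i * ((∑ l ∈ range n, Real.sqrt (kk i / (kk i + l + 1))) / kk i) := by
  rw [mul_sum]
  refine sum_le_sum fun i hi => ?_
  have h := window_mass_weight_le hy (hk i hi) n hS1
  calc x i * (y / kk i) ≤ x i * ((y / ∑ l ∈ range n, Real.sqrt ((y + 1) / ((y + 1) + l + 1))) *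
        ((∑ l ∈ range n, Real.sqrt (kk i / (kk i + l + 1))) / kk i)) := mul_le_mul_of_nonneg_left h (hx i hi)
    _ = _ := by ring

/-- `c_Ω·s_y ≤ 1`: `(y∕S_{y+1,y})·(S_{y,y}∕y) = S_{y,y}∕S_{y+1,y} ≤ 1`. [folklore] -/
theorem cOmega_mul_s_le_one {y : ℝ} (hy : 0 < y) (n : ℕ) (hS1 : 0 < ∑ l ∈ range n, Real.sqrt ((y + 1) / ((y + 1) + l + 1))) :
    (y / ∑ l ∈ range n, Real.sqrt ((y + 1) / ((y + 1) + l + 1))) * ((∑ l ∈ range n, Real.sqrt (y / (y + l + 1))) / y) ≤ 1 := by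
  have hmono := readWindow_mono_left (k := y) (k' := y + 1) hy.le (by linarith) n
  rw [div_mul_div_comm, div_le_one (mul_pos hS1 hy)]
  nlinarith

/-- The lower bound behind `c_Ω ≤ √2`: `S_{y+1,y} ≥ y∕√2` (indeed every summand is `≥ √((y+1)∕(2y+1)) > 1∕√2`; we use (E65a)'s form `j·√(k∕(k+j)) ≤ S_{k,j}`
re-proved here for real `k`). [folklore] -/
theorem readWindow_succ_ge (y : ℕ) :
    (y : ℝ) / Real.sqrt 2 ≤ ∑ l ∈ range y, Real.sqrt (((y : ℝ) + 1) / (((y : ℝ) + 1) + l + 1)) := by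
  have hy : (0 : ℝ) ≤ y := Nat.cast_nonneg y
  have hterm : ∀ l ∈ range y, Real.sqrt (1 / 2) ≤ Real.sqrt (((y : ℝ) + 1) / (((y : ℝ) + 1) + l + 1)) := by
    intro l hl
    have hl : (l : ℝ) + 1 ≤ y := by exact_mod_cast mem_range.mp hl
    have hl0 : (0 : ℝ) ≤ l := Nat.cast_nonneg l
    apply Real.sqrt_le_sqrt
    rw [div_le_div_iff₀ (by norm_num) (by linarith)]
    linarith
  have hsum := sum_le_sum hterm
  rw [sum_const, card_range, nsmul_eq_mul] at hsum
  have hs2 : Real.sqrt (1 / 2) = 1 / Real.sqrt 2 := by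
    rw [Real.sqrt_div zero_le_one, Real.sqrt_one]
  rw [hs2, mul_one_div] at hsum
  exact hsum

/-- **`c_Ω ≤ √2`** (so the window-mass chain is never worse than route (N)'s `√2·W` chain) **and `c_Ω < 2`**, for every young age `y ≥ 1`. [folklore] -/
theorem cOmega_le_sqrt_two {y : ℕ} (hy : 1 ≤ y) :
    (y : ℝ) / ∑ l ∈ range y, Real.sqrt (((y : ℝ) + 1) / (((y : ℝ) + 1) + l + 1)) ≤ Real.sqrt 2 ∧
    (y : ℝ) / ∑ l ∈ range y, Real.sqrt (((y : ℝ) + 1) / (((y : ℝ) + 1) + l + 1)) < 2 := by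
  have hyr : (0 : ℝ) < y := by exact_mod_cast hy
  have hsq : 0 < Real.sqrt 2 := Real.sqrt_pos.mpr (by norm_num)
  have hsq2 : Real.sqrt 2 < 2 := by
    have h2 : Real.sqrt 2 * Real.sqrt 2 = 2 := Real.mul_self_sqrt (by norm_num)
    nlinarith
  have hS := readWindow_succ_ge y
  have hS0 : 0 < ∑ l ∈ range y, Real.sqrt (((y : ℝ) + 1) / (((y : ℝ) + 1) + l + 1)) := lt_of_lt_of_le (by positivity) hS
  have h1 : (y : ℝ) / ∑ l ∈ range y, Real.sqrt (((y : ℝ) + 1) / (((y : ℝ) + 1) + l + 1)) ≤ Real.sqrt 2 := by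
    rw [div_le_iff₀ hS0]
    have := mul_le_mul_of_nonneg_left hS hsq.le
    rw [mul_div_cancel₀ _ hsq.ne'] at this
    linarith
  exact ⟨h1, lt_of_le_of_lt h1 hsq2⟩

/-! ## §3 The threshold for large young ages: `1 − y∕(2S_{y,y}) ≥ 0.391` for `y ≥ 40` -/

/-- Certified decimals: `√(2 + 1∕40) ≥ 1.42302` and `√(1 + 1∕40) ≤ 1.01243`. [folklore] -/
theorem sqrt_enclosures_forty : (1.42302 : ℝ) ≤ Real.sqrt (2 + 1 / 40) ∧ Real.sqrt (1 + 1 / 40) ≤ 1.01243 := by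
  constructor
  · rw [show (1.42302 : ℝ) = Real.sqrt (1.42302 ^ 2) from (Real.sqrt_sq (by norm_num)).symm]
    exact Real.sqrt_le_sqrt (by norm_num)
  · calc Real.sqrt (1 + 1 / 40) ≤ Real.sqrt (1.01243 ^ 2) := Real.sqrt_le_sqrt (by norm_num)
      _ = 1.01243 := Real.sqrt_sq (by norm_num)

/-- Hence `S_{y,y} ≥ 0.82118·y` for `y ≥ 40` (telescoped lower bound `S_{k,j} ≥ 2k(√(1+(j+1)∕k) − √(1+1∕k))` of (E66)∕(E72d) at `k = j = y`, and
`t ↦ √(2+t) − √(1+t)` non-increasing), so the lone cap is `≤ 0.6089` and the closure threshold `1 − y∕(2S_{y,y}) ≥ 0.3911` for every young age `y ≥ 40`.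
Stated on the telescoped form (the tree's `le_readWindow_ratio` supplies `2y(√(1+(y+1)∕y) − √(1+1∕y)) ≤ S_{y,y}`). [folklore] -/
theorem telescope_ge_forty {y : ℝ} (hy : 40 ≤ y) :
    0.82118 * y ≤ 2 * y * (Real.sqrt (1 + (y + 1) / y) - Real.sqrt (1 + 1 / y)) := by
  have hy0 : 0 < y := by linarith
  obtain ⟨hlo, hhi⟩ := sqrt_enclosures_forty
  have h1 : 1 + (y + 1) / y = 2 + 1 / y := by field_simp; ring
  rw [h1]
  -- √(2 + t) − √(1 + t) is non-increasing in t: compare at t = 1/y ≤ 1/40 via (√(2+t) − √(1+t))(√(2+t) + √(1+t)) = 1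
  have ht : 1 / y ≤ 1 / 40 := one_div_le_one_div_of_le (by norm_num) hy
  have ht0 : 0 < 1 / y := by positivity
  set t := 1 / y with ht_def
  have hA : 0 ≤ Real.sqrt (2 + t) := Real.sqrt_nonneg _
  have hB : 0 ≤ Real.sqrt (1 + t) := Real.sqrt_nonneg _
  have hA' : Real.sqrt (2 + t) ≤ Real.sqrt (2 + 1 / 40) := Real.sqrt_le_sqrt (by linarith)
  have hB' : Real.sqrt (1 + t) ≤ Real.sqrt (1 + 1 / 40) := Real.sqrt_le_sqrt (by linarith)
  have hprod : (Real.sqrt (2 + t) - Real.sqrt (1 + t)) * (Real.sqrt (2 + t) + Real.sqrt (1 + t)) = 1 := by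
    have e1 : Real.sqrt (2 + t) * Real.sqrt (2 + t) = 2 + t := Real.mul_self_sqrt (by linarith)
    have e2 : Real.sqrt (1 + t) * Real.sqrt (1 + t) = 1 + t := Real.mul_self_sqrt (by linarith)
    nlinarith
  have hsumpos : 0 < Real.sqrt (2 + t) + Real.sqrt (1 + t) := by
    have : 0 < Real.sqrt (2 + t) := Real.sqrt_pos.mpr (by linarith)
    linarith
  -- difference = 1/(sum) ≥ 1/(√2.025 + 1.01243)
  have hdiffeq : Real.sqrt (2 + t) - Real.sqrt (1 + t) = 1 / (Real.sqrt (2 + t) + Real.sqrt (1 + t)) := by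
    rw [eq_div_iff hsumpos.ne']; exact hprod
  have hdiff : 1 / (Real.sqrt (2 + 1 / 40) + 1.01243) ≤ Real.sqrt (2 + t) - Real.sqrt (1 + t) := by
    rw [hdiffeq]; exact one_div_le_one_div_of_le hsumpos (by linarith)
  have hnum : (0.41059 : ℝ) ≤ 1 / (Real.sqrt (2 + 1 / 40) + 1.01243) := by
    rw [le_div_iff₀ (by linarith)]
    have hup : Real.sqrt (2 + 1 / 40) ≤ 1.42303 := by
      calc Real.sqrt (2 + 1 / 40) ≤ Real.sqrt (1.42303 ^ 2) := Real.sqrt_le_sqrt (by norm_num)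
        _ = 1.42303 := Real.sqrt_sq (by norm_num)
    nlinarith
  nlinarith

/-! ## §4 The pure spike of the window-mass chain is alive for EVERY defect -/

/-- `e > 8∕3`, hence `e⁻¹ < 3∕8`. [folklore] -/
theorem exp_neg_one_lt : Real.exp (-1) < 3 / 8 := by
  have h := Real.exp_one_gt_d9
  rw [Real.exp_neg, inv_lt_comm₀ (Real.exp_pos 1) (by norm_num)]
  linarith

/-- **THE PURE SPIKE OF THE WINDOW-MASS CHAIN NEVER BLOWS UP INSIDE THE BUDGET.**  For every defect `0 < θ < 1` and every consumed load `X ≤ 5∕8`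
(the single-scale cap is `(√2+1)∕4 = 0.6036 < 5∕8`): **`θ < (1 − X)^{1−θ}`**, i.e. `θ·q(X) < 1` for the closed-form exponent `q(X) = (1∕(1−X))^{1−θ}` of the
constant-coefficient spike fluid of (E72e)∕(E73a) with the window-mass constants `κ = 1` (weights `y∕k ≤ 1`), `D₀ = 1`, `a = 1 − θ`, `a + θ = 1` (no pump).
Proof: `log θ < θ − 1 = −(1−θ)` (strict concavity of `log`, `θ ≠ 1`) and `(1−θ)·log(1−X) ≥ (1−θ)·log(3∕8) > −(1−θ)` because `3∕8 > e⁻¹`.  So the blow-up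
load `X⋆(θ) = 1 − θ^{1∕(1−θ)} > 1 − e⁻¹ = 0.632` exceeds the cap for EVERY `θ` — whereas for route (N)'s `√2·W` chain (`κ = 4 − 2√2`) the pure spike is alive
only because `θ̄(1) = 0.7856 < 0.7987` ((E73d) `pure_spike_alive`, margin 0.021 in load). [folklore] -/
theorem pure_spike_alive_all_defects {θ X : ℝ} (hθ0 : 0 < θ) (hθ1 : θ < 1) (hX : X ≤ 5 / 8) :
    θ < (1 - X) ^ (1 - θ) := by
  have h1X : 0 < 1 - X := by linarith
  have hlogθ : Real.log θ < -(1 - θ) := by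
    have := Real.log_lt_sub_one_of_pos hθ0 (ne_of_lt hθ1); linarith
  have hlog1X : -1 < Real.log (1 - X) := by
    have h38 : Real.log (Real.exp (-1)) < Real.log (1 - X) :=
      Real.log_lt_log (Real.exp_pos _) (by linarith [exp_neg_one_lt])
    rwa [Real.log_exp] at h38
  have hkey : Real.log θ < (1 - θ) * Real.log (1 - X) := by nlinarith
  calc θ = Real.exp (Real.log θ) := (Real.exp_log hθ0).symm
    _ < Real.exp ((1 - θ) * Real.log (1 - X)) := Real.exp_lt_exp.mpr hkey
    _ = (1 - X) ^ (1 - θ) := by rw [Real.rpow_def_of_pos h1X, mul_comm]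

/-- The same in the letters of (E73a) `spike_le_closed_form` ∕ (E72e) `hasDerivAt_spike_closed_form` (`q(t) = (D₀∕(D₀ − κt))^{a∕κ}∕(a + θ)` with `D₀ = 1`,
`κ = 1`, `a = 1 − θ`): **`θ·q(X) < 1`** for `0 < θ < 1`, `0 ≤ X ≤ 5∕8` — the hypothesis `θ·q(t_M) < 1` of `spike_le_closed_form` holds on the whole budget, so
every discrete pure spike of the window-mass chain is dominated by a FINITE closed form and closes member by member. [folklore] -/
theorem pure_spike_closed_form_alive {θ X : ℝ} (hθ0 : 0 < θ) (hθ1 : θ < 1) (hX : X ≤ 5 / 8) :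
    θ * ((1 / (1 - 1 * X)) ^ ((1 - θ) / 1) / ((1 - θ) + θ)) < 1 := by
  have h1X : 0 < 1 - X := by linarith
  have hpow := pure_spike_alive_all_defects hθ0 hθ1 hX
  have hpos : 0 < (1 - X) ^ (1 - θ) := Real.rpow_pos_of_pos h1X _
  rw [one_mul, div_one, show (1 - θ) + θ = 1 by ring, div_one, one_div, Real.inv_rpow h1X.le, ← div_eq_mul_inv,
    div_lt_one hpos]
  exact hpow

/-- The finite value: with `E(X) = a·q∕(1 − θq)` ((E72e) closed form), `a = 1 − θ`, the pure spike's compounding at the cap obeys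
`E(X) = (1−θ)(1−X)^{−(1−θ)}∕(1 − θ(1−X)^{−(1−θ)})`; positivity of the denominator is `pure_spike_alive_all_defects`. Recorded as the positivity statement
used downstream. [folklore] -/
theorem pure_spike_denominator_pos {θ X : ℝ} (hθ0 : 0 < θ) (hθ1 : θ < 1) (hX : X ≤ 5 / 8) :
    0 < 1 - θ * ((1 - X) ^ (1 - θ))⁻¹ := by
  have h1X : 0 < 1 - X := by linarith
  have hpow := pure_spike_alive_all_defects hθ0 hθ1 hX
  have hpos : 0 < (1 - X) ^ (1 - θ) := Real.rpow_pos_of_pos h1X _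
  rw [sub_pos, ← div_eq_mul_inv, div_lt_one hpos]
  exact hpow

/-! ## §5 The packaged step criterion of the window-mass chain -/

/-- `S_{y,y} > 0` for `y ≥ 1`. [folklore] -/
theorem readWindow_self_pos {y : ℕ} (hy : 1 ≤ y) : 0 < ∑ l ∈ range y, Real.sqrt ((y : ℝ) / ((y : ℝ) + l + 1)) := by
  have hyr : (0 : ℝ) < y := by exact_mod_cast hy
  apply sum_pos _ (nonempty_range_iff.mpr (by omega))
  intro l _
  have hl : (0 : ℝ) ≤ l := Nat.cast_nonneg l
  exact Real.sqrt_pos.mpr (by positivity)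

/-- **THE STEP CRITERION OF THE WINDOW-MASS CHAIN (packaged).**  A young age `y ≥ 1` with load `x₀ ≥ 0`, finitely many OLDER ages `k_i ≥ y + 1` (real) with
loads `x_i ≥ 0`, obeying (E65a)'s window budget at the young scale `(S_{y,y}∕y)·x₀ + Σ_i x_i·S_{k_i,y}∕k_i ≤ ½`, and a chain load `V ≥ 0` with
**`x₀·V ≤ T < 1 − y∕(2S_{y,y})`**.  Then the window-mass denominator is positive and the KEY ratio closes:
**`x₀(1+V)∕(1 − Σ_i x_i·y∕k_i) < 1`**.  (§2: `Ω^u ≤ c_Ω W`, `c_Ω s_y ≤ 1`, `c_Ω < 2`; §1: `ρ ≤ 1∕(2s_y) + T`.)  This is the inequality the identification file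
instantiates at every step of the static chain of (E71d) with `Ω_m ≤ Ω^u` (undamped old kernel mass inside the young window) in place of route (N)'s `√2·W`.
[folklore] -/
theorem window_mass_step_closes {ι : Type*} (I : Finset ι) {y : ℕ} (hy : 1 ≤ y) (kk x : ι → ℝ)
    (hk : ∀ i ∈ I, (y : ℝ) + 1 ≤ kk i) (hx : ∀ i ∈ I, 0 ≤ x i) {x₀ V T : ℝ} (hx0 : 0 ≤ x₀) (hV : 0 ≤ V)
    (hbudget : ((∑ l ∈ range y, Real.sqrt ((y : ℝ) / ((y : ℝ) + l + 1))) / y) * x₀ +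
      ∑ i ∈ I, x i * ((∑ l ∈ range y, Real.sqrt (kk i / (kk i + l + 1))) / kk i) ≤ 1 / 2)
    (hT : x₀ * V ≤ T) (hTc : T < 1 - (y : ℝ) / (2 * ∑ l ∈ range y, Real.sqrt ((y : ℝ) / ((y : ℝ) + l + 1)))) :
    0 < 1 - ∑ i ∈ I, x i * ((y : ℝ) / kk i) ∧ x₀ * (1 + V) / (1 - ∑ i ∈ I, x i * ((y : ℝ) / kk i)) < 1 := by
  have hyr : (0 : ℝ) < y := by exact_mod_cast hy
  set Syy := ∑ l ∈ range y, Real.sqrt ((y : ℝ) / ((y : ℝ) + l + 1)) with hSyy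
  set Sy1 := ∑ l ∈ range y, Real.sqrt (((y : ℝ) + 1) / (((y : ℝ) + 1) + l + 1)) with hSy1
  set W := ∑ i ∈ I, x i * ((∑ l ∈ range y, Real.sqrt (kk i / (kk i + l + 1))) / kk i) with hWdef
  set Ω := ∑ i ∈ I, x i * ((y : ℝ) / kk i) with hΩdef
  have hSpos : 0 < Syy := readWindow_self_pos hy
  have hS1 : 0 < Sy1 := lt_of_lt_of_le (by positivity) (readWindow_succ_ge y)
  have hs : 0 < Syy / y := by positivity
  have hc : 0 ≤ (y : ℝ) / Sy1 := by positivity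
  have hΩ : Ω ≤ ((y : ℝ) / Sy1) * W := window_mass_le_mul_usage I hyr y kk x hk hx hS1
  have hcs : ((y : ℝ) / Sy1) * (Syy / y) ≤ 1 := cOmega_mul_s_le_one hyr y hS1
  have hc2 : (y : ℝ) / Sy1 < 2 := (cOmega_le_sqrt_two hy).2
  have hW : 0 ≤ W := sum_nonneg fun i hi => mul_nonneg (hx i hi) (by
    have : 0 < kk i := by linarith [hk i hi]
    have hki : (0 : ℝ) ≤ kk i := this.le
    exact div_nonneg (sum_nonneg fun l _ => Real.sqrt_nonneg _) hki)
  have hTc' : T < 1 - 1 / (2 * (Syy / y)) := by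
    have : 1 / (2 * (Syy / y)) = (y : ℝ) / (2 * Syy) := by field_simp
    rw [this]; exact hTc
  have hpos : 0 < 1 - Ω := by
    have hW12 : W ≤ 1 / 2 := by nlinarith [mul_nonneg hs.le hx0]
    have h1 : ((y : ℝ) / Sy1) * W ≤ ((y : ℝ) / Sy1) * (1 / 2) := mul_le_mul_of_nonneg_left hW12 hc
    linarith
  exact ⟨hpos, key_ratio_lt_one_of_product_lt_crit hx0 hV hW hΩ hc hbudget hs hcs hc2 hT hTc'⟩

/-! ## §6 (appended, same generation) The aliveness hypothesis of (E73a) `spike_le_closed_form` in ITS OWN LETTERS -/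

/-- **`hqM` OF (E73a) `spike_le_closed_form` FOR THE PURE SPIKE OF THE WINDOW-MASS CHAIN.**  In the exp∕log letters of (E73a) (`q(t) = exp((a∕κ')·(log D₀ −
log(D₀ − κ't)))∕(a + θ)`) with the window-mass constants `D₀ = 1`, `κ' = 1`, `a = 1 − θ`: for every defect `0 < θ < 1` and every consumed load `t ≤ 5∕8`,
**`θ · (exp(((1−θ)∕1)·(log 1 − log(1 − 1·t)))∕((1−θ) + θ)) < 1`** — so `spike_le_closed_form` applies to every discrete pure spike of the window-mass chain on the
whole budget (`t_M ≤ (√2+1)∕4 < 5∕8`), with no condition on `θ`.  (`pure_spike_alive_all_defects` rewritten through `Real.rpow_def_of_pos`.) [folklore] -/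
theorem pure_spike_hqM {θ t : ℝ} (hθ0 : 0 < θ) (hθ1 : θ < 1) (ht : t ≤ 5 / 8) :
    θ * (Real.exp ((1 - θ) / 1 * (Real.log 1 - Real.log (1 - 1 * t))) / ((1 - θ) + θ)) < 1 := by
  have h1t : 0 < 1 - t := by linarith
  have hpow := pure_spike_alive_all_defects hθ0 hθ1 ht
  have hpos : 0 < (1 - t) ^ (1 - θ) := Real.rpow_pos_of_pos h1t _
  have hexp : Real.exp ((1 - θ) / 1 * (Real.log 1 - Real.log (1 - 1 * t))) = ((1 - t) ^ (1 - θ))⁻¹ := by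
    rw [div_one, one_mul, Real.log_one, zero_sub, mul_neg, Real.exp_neg, Real.rpow_def_of_pos h1t, mul_comm]
  rw [hexp, show (1 - θ) + θ = 1 by ring, div_one, ← div_eq_mul_inv, div_lt_one hpos]
  exact hpow

end Summit.QuantumFields.BalabanUV.Beta.EriceRemainderEnclosureHistoryAutonomyComparisonAgeCompositionStaticChainWindowMass

end
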